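import Summits.MatrixMultiplication.MatrixMultiplication.Theorems.OutsiderSandwichDelayLadder
import Summits.MatrixMultiplication.MatrixMultiplication.Theorems.FarEdgeDescentSymmetricCover
import Summits.MatrixMultiplication.MatrixMultiplication.Theorems.FarEdgeDescentTwistedStar
import Summits.MatrixMultiplication.MatrixMultiplication.Theorems.FarEdgeDescentCouplingBridge
import HarnessLib

/-!
# The delay rung `d(3) = 1`: `C₁^{⊠4} ⊵ ⟨2,2,2⟩^{⊠3}`, and `d(N) ≤ ⌈N/3⌉`

Route `OutsiderSandwich` (decomposition cell `decomp-mm`, lens 4 «minimal counterexample /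
extremal reduction», gen 28), support for the aside leaf `BlockOneIsMM`
(stmt-MatrixMultiplication-27147).

`OutsiderSandwichDelayLadder` left the first undecided DELAY rung as `delayNumber 3 ∈ {1, 2}`
(`delayNumber_three`), i.e. the question `Delayed 3 1 : C₁^{⊠4} ⊵ ⟨2,2,2⟩^{⊠3}` — four factors of
lens 4's coupled Coppersmith–Winograd block `C₁` against three factors of `⟨2,2,2⟩` — and reduced
it to the open HELP rung `Helped 3 2` (`delayed_three_one_of_helped`).  The census seat
(`decomp-mm-census` g23, row I81, critic-verified) found that the delay rung holds WITHOUT the help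
rung, by a structural chain through lens 2's twisted star `𝔖₂(L)` (`(X; Y, Y') ↦ (XY, XᵀY')`,
`FarEdgeDescentTwistedStarCore`), of which `C₁` is the leg-rotation (`FarEdgeDescentCouplingBridge`):

1. `𝔖₂(1) ⊵ ⟨2⟩ ⊠ ⟨1,1,2⟩` — restrict the shared matrix to a DIAGONAL `X = diag(x₀, x₁)`: the two
   leaves then compute `(x_κ y_κ)_κ` and `(x_κ y'_κ)_κ`, two independent scalar-times-pair products
   (`twistedStar_restrictsTo_unitTwo_kronecker_matMul112`);
2. `𝔖₂(1) ⊠ ⟨1,1,2⟩ ⊵ 𝔖₂(2) ⊵ ⟨2,2,2⟩` (lens 2: Kronecker factorisation + coherent leaf);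
3. `⟨2⟩ ⊠ 𝔖₂(1)^{⊠2} ⊵ ⟨2,2,2⟩^{⊠2}` (lens 2's symmetric cover = the help rung `r(2) = 2`).

In the tensor semiring `T(K)` these give
`[𝔖]^4 = [𝔖]^2·[𝔖]·[𝔖] ≥ [𝔖]^2·[𝔖]·2[⟨1,1,2⟩] = (2[𝔖]^2)·([𝔖][⟨1,1,2⟩]) ≥ [⟨2,2,2⟩]^2·[⟨2,2,2⟩]`
(`twistedStar_pow_four_restrictsTo_matMul_pow_three`, every commutative ring `K`), and rotating the
legs (`⟨2,2,2⟩` is cyclically symmetric) yields over `ℂ`: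

* `delayed_three_one : Delayed 3 1`, `delayNumber_three_eq_one : delayNumber 3 = 1`;
* `delayed_three_mul : Delayed (3q) q`, `delayed_third : Delayed N ⌈N/3⌉`,
  `delayNumber_le_third : d(N) ≤ ⌈N/3⌉` — the delay ladder drops from slope `1/2`
  (`delayNumber_le_half`) to slope `1/3`.

Placement.  The factor bought by step 1 is spent as the COPY that step 3 needs: one factor of
`C₁` is worth `2·⟨1,1,2⟩ ≥ 2`, and the spare `⟨1,1,2⟩` upgrades another factor to a full `⟨2,2,2⟩`
(step 2) — so four factors do the work of «two copies of three factors» although `Helped 3 2`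
itself stays open (census: numerically `r(3) = 3`).  In exponent currency the rung is weak
(`θ ≤ 3·1/3 = 1`); its content is structural: the delay number is NOT `⌈N/2⌉`, and the leaf
`BlockOneIsMM ⟺ d(N) = o(N)` (`blockOneIsMM_iff_sublinearDelay`) now starts from slope `1/3`.

## References

* D. Coppersmith, S. Winograd, *Matrix multiplication via arithmetic progressions*,
  J. Symbolic Comput. 9 (1990) 251–280, §6–§7. [CoppersmithWinograd1990]
* M. Bläser, *Fast Matrix Multiplication*, Theory of Computing Graduate Surveys 5 (2013), §5–§6.
  [Blaser2013]
* M. Christandl, P. Vrana, J. Zuiddam, *Universal points in the asymptotic spectrum of tensors*,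
  J. Amer. Math. Soc. 36 (2023) 31–79, §1.1. [ChristandlVranaZuiddam2023]
-/

noncomputable section

open scoped BigOperators

set_option linter.dupNamespace false
set_option autoImplicit false

namespace Summit.MatrixMultiplication.MatrixMultiplication.Theorems.OutsiderSandwichDelayThree

open Literature.Computability.AlgebraicComplexity
open Summit.MatrixMultiplication.MatrixMultiplication.Theorems.OutsiderSandwichCoupling (coupling₁)
open Summit.MatrixMultiplication.MatrixMultiplication.Theorems.OutsiderSandwichExchangeRate
  (Helped)
open Summit.MatrixMultiplication.MatrixMultiplication.Theorems.OutsiderSandwichDelayLadder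
open Summit.MatrixMultiplication.MatrixMultiplication.Theorems.FarEdgeDescentTwistedStar
open Summit.MatrixMultiplication.MatrixMultiplication.Theorems.FarEdgeDescentSymmetricCover
  (matMulSq_le_unitTwo_twistedStarSq)
open Summit.MatrixMultiplication.MatrixMultiplication.Theorems.FarEdgeDescentCouplingBridge
  (coupling₁_restrictsTo_rotate_twistedStar)

universe u

/-! ## 1. The twisted star with a diagonal matrix: `𝔖₂(1) ⊵ ⟨2⟩ ⊠ ⟨1,1,2⟩` -/

section General

variable {K : Type u} [CommRing K]

/-- **`𝔖₂(1) ⊵ ⟨2⟩ ⊠ ⟨1,1,2⟩`**: restricting the shared matrix of the twisted star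
`(X; Y, Y') ↦ (XY, XᵀY')` to a diagonal `X = diag(x₀, x₁)` leaves the two independent products
`x_κ · (y_κ, y'_κ)`, `κ = 0, 1` — two copies of scalar-times-pair `⟨1,1,2⟩` (a coordinate
restriction: the `z`/`y`-index `(κ, ν)` goes to leaf `ν` at row `κ`, the `x`-index `κ` to the
diagonal entry `(κ, κ)`). [cite: Blaser2013, §5] -/
theorem twistedStar_restrictsTo_unitTwo_kronecker_matMul112 :
    TensorRestrictsTo (twistedStar K 2 1)
      (kroneckerTensor (unitTensor K 2) (matMulTensor K 1 1 2)) := by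
  have matMulTensor_apply' : ∀ (k m n : ℕ) (a : Fin k × Fin n) (b : Fin k × Fin m)
      (c : Fin m × Fin n),
      matMulTensor K k m n a b c = if a.1 = b.1 ∧ b.2 = c.1 ∧ a.2 = c.2 then 1 else 0 :=
    fun _ _ _ _ _ _ => rfl
  have e : (fun (a : Fin 2 × (Fin 1 × Fin 2)) (b : Fin 2 × (Fin 1 × Fin 1))
      (c : Fin 2 × (Fin 1 × Fin 2)) =>
      twistedStar K 2 1
        ((fun p : Fin 2 × (Fin 1 × Fin 2) =>
          if p.2.2 = 0 then (Sum.inl (p.1, 0) : (Fin 2 × Fin 1) ⊕ (Fin 2 × Fin 1))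
          else Sum.inr (p.1, 0)) a)
        ((fun p : Fin 2 × (Fin 1 × Fin 1) => ((p.1, p.1) : Fin 2 × Fin 2)) b)
        ((fun p : Fin 2 × (Fin 1 × Fin 2) =>
          if p.2.2 = 0 then (Sum.inl (p.1, 0) : (Fin 2 × Fin 1) ⊕ (Fin 2 × Fin 1))
          else Sum.inr (p.1, 0)) c)) =
      kroneckerTensor (unitTensor K 2) (matMulTensor K 1 1 2) := by
    funext a b c
    obtain ⟨i, ⟨a₀, ν⟩⟩ := a
    obtain ⟨j, ⟨b₀, b₁⟩⟩ := b
    obtain ⟨k, ⟨c₀, ν'⟩⟩ := c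
    have ha : a₀ = 0 := Subsingleton.elim _ _
    have hb : b₀ = 0 := Subsingleton.elim _ _
    have hb' : b₁ = 0 := Subsingleton.elim _ _
    have hc : c₀ = 0 := Subsingleton.elim _ _
    subst ha hb hb' hc
    simp only [kroneckerTensor_apply, unitTensor_apply]
    fin_cases i <;> fin_cases j <;> fin_cases k <;> fin_cases ν <;> fin_cases ν' <;>
      simp [matMulTensor_apply', Prod.swap]
  rw [← e]
  exact tensorRestrictsTo_precomp _ _ _ _

/-- **`𝔖₂(1) ⊠ ⟨1,1,2⟩ ⊵ ⟨2,2,2⟩`**: the spare pair upgrades a twisted star to `𝔖₂(2)`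
(`tensorRestrictsTo_kronecker_twistedStar_one`), whose coherent leaf is `⟨2,2,2⟩`
(`tensorRestrictsTo_twistedStar_matMul`). [cite: Blaser2013, §5] -/
theorem twistedStar_kronecker_matMul112_restrictsTo_matMul :
    TensorRestrictsTo (kroneckerTensor (twistedStar K 2 1) (matMulTensor K 1 1 2))
      (matMulTensor K 2 2 2) :=
  (tensorRestrictsTo_kronecker_twistedStar_one 2 2).trans (tensorRestrictsTo_twistedStar_matMul 2 2)

/-! ## 2. The chain in `T(K)`: `[𝔖₂(1)]^4 ≥ [⟨2,2,2⟩]^3` -/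

/-- `2·[⟨1,1,2⟩] ≤ [𝔖₂(1)]` in `T(K)`. [cite: ChristandlVranaZuiddam2023, §1.1] -/
theorem two_mul_mk_matMul112_le_mk_twistedStar :
    (2 : TensorClass K) * TensorClass.mk (matMulTensor K 1 1 2) ≤
      TensorClass.mk (twistedStar K 2 1) := by
  rw [show (2 : TensorClass K) = ((2 : ℕ) : TensorClass K) from rfl, TensorClass.natCast_eq_mk,
    TensorClass.mk_mul_mk, TensorClass.mk_le_mk_iff]
  exact twistedStar_restrictsTo_unitTwo_kronecker_matMul112

/-- `[⟨2,2,2⟩] ≤ [𝔖₂(1)]·[⟨1,1,2⟩]` in `T(K)`. [cite: ChristandlVranaZuiddam2023, §1.1] -/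
theorem mk_matMul_le_mk_twistedStar_mul_mk_matMul112 :
    TensorClass.mk (matMulTensor K 2 2 2) ≤
      TensorClass.mk (twistedStar K 2 1) * TensorClass.mk (matMulTensor K 1 1 2) := by
  rw [TensorClass.mk_mul_mk, TensorClass.mk_le_mk_iff]
  exact twistedStar_kronecker_matMul112_restrictsTo_matMul

/-- `[⟨2,2,2⟩]^2 ≤ 2·[𝔖₂(1)]^2` in `T(K)` (lens 2's symmetric cover).
[cite: ChristandlVranaZuiddam2023, §1.1] -/
theorem mk_matMul_sq_le_two_mul_mk_twistedStar_sq :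
    TensorClass.mk (matMulTensor K 2 2 2) ^ 2 ≤
      (2 : TensorClass K) * TensorClass.mk (twistedStar K 2 1) ^ 2 := by
  rw [show (2 : TensorClass K) = ((2 : ℕ) : TensorClass K) from rfl, TensorClass.natCast_eq_mk,
    TensorClass.mk_pow, TensorClass.mk_pow, TensorClass.mk_mul_mk, TensorClass.mk_le_mk_iff]
  exact matMulSq_le_unitTwo_twistedStarSq

/-- **`[⟨2,2,2⟩]^3 ≤ [𝔖₂(1)]^4` in `T(K)`**:
`[M]^3 = [M]^2·[M] ≤ (2[𝔖]^2)·([𝔖][U]) = [𝔖]^2·[𝔖]·(2[U]) ≤ [𝔖]^2·[𝔖]·[𝔖] = [𝔖]^4`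
with `U = ⟨1,1,2⟩`. [cite: ChristandlVranaZuiddam2023, §1.1] -/
theorem mk_matMul_pow_three_le_mk_twistedStar_pow_four :
    TensorClass.mk (matMulTensor K 2 2 2) ^ 3 ≤ TensorClass.mk (twistedStar K 2 1) ^ 4 := by
  set M := TensorClass.mk (matMulTensor K 2 2 2) with hM
  set S := TensorClass.mk (twistedStar K 2 1) with hS
  set U := TensorClass.mk (matMulTensor K 1 1 2) with hU
  calc M ^ 3 = M ^ 2 * M := pow_succ M 2
    _ ≤ ((2 : TensorClass K) * S ^ 2) * (S * U) :=
        TensorClass.mul_le_mul mk_matMul_sq_le_two_mul_mk_twistedStar_sq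
          mk_matMul_le_mk_twistedStar_mul_mk_matMul112
    _ = (S ^ 2 * S) * ((2 : TensorClass K) * U) := by ring
    _ ≤ (S ^ 2 * S) * S := TensorClass.mul_le_mul le_rfl two_mul_mk_matMul112_le_mk_twistedStar
    _ = S ^ 4 := by ring

/-- **`𝔖₂(1)^{⊠4} ⊵ ⟨2,2,2⟩^{⊠3}`** over every commutative ring: four Kronecker factors of the
twisted star restrict to three of `⟨2,2,2⟩`. [cite: ChristandlVranaZuiddam2023, §1.1] -/
theorem twistedStar_pow_four_restrictsTo_matMul_pow_three :
    TensorRestrictsTo (kroneckerPow (twistedStar K 2 1) 4)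
      (kroneckerPow (matMulTensor K 2 2 2) 3) := by
  rw [← TensorClass.mk_le_mk_iff, ← TensorClass.mk_pow, ← TensorClass.mk_pow]
  exact mk_matMul_pow_three_le_mk_twistedStar_pow_four

end General

/-! ## 3. Over `ℂ`: the delay rung `d(3) = 1` and the slope `1/3` -/

section Complex

/-- **THE RUNG `Delayed 3 1`: `C₁^{⊠4} ⊵ ⟨2,2,2⟩^{⊠3}`** — transport of
`twistedStar_pow_four_restrictsTo_matMul_pow_three` along the rotation bridge `C₁ ⊵ rotate 𝔖₂(1)`
and the cyclic symmetry `rotate ⟨2,2,2⟩ ⊵ ⟨2,2,2⟩`.  Settles the first undecided delay rung of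
`OutsiderSandwichDelayLadder` (`delayNumber_three`) without the help rung `Helped 3 2`.
[cite: CoppersmithWinograd1990, §7] -/
theorem delayed_three_one : Delayed 3 1 := by
  have h : TensorRestrictsTo (kroneckerPow (rotate (twistedStar ℂ 2 1)) 4)
      (kroneckerPow (rotate (matMulTensor ℂ 2 2 2)) 3) :=
    (twistedStar_pow_four_restrictsTo_matMul_pow_three (K := ℂ)).rotate
  have h₁ : TensorRestrictsTo (kroneckerPow coupling₁ 4)
      (kroneckerPow (rotate (twistedStar ℂ 2 1)) 4) :=
    coupling₁_restrictsTo_rotate_twistedStar.kroneckerPow 4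
  have h₂ : TensorRestrictsTo (kroneckerPow (rotate (matMulTensor ℂ 2 2 2)) 3)
      (kroneckerPow (matMulTensor ℂ 2 2 2) 3) :=
    (tensorRestrictsTo_rotate_matMulTensor ℂ 2 2 2).kroneckerPow 3
  exact (h₁.trans h).trans h₂

/-- **`d(3) = 1`.** [cite: CoppersmithWinograd1990, §7] -/
theorem delayNumber_three_eq_one : delayNumber 3 = 1 :=
  delayNumber_three_eq_one_iff.2 delayed_three_one

/-- `Delayed 0 0` (empty Kronecker powers). [folklore] -/
theorem delayed_zero_zero : Delayed 0 0 := by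
  rw [delayed_iff_le]
  simp

/-- **`C₁^{⊠4q} ⊵ ⟨2,2,2⟩^{⊠3q}`**: delay rate `1/3` along multiples of `3`.
[cite: CoppersmithWinograd1990, §7] -/
theorem delayed_three_mul (q : ℕ) : Delayed (3 * q) q := by
  induction q with
  | zero => simpa using delayed_zero_zero
  | succ q ih =>
    have h := delayed_add ih delayed_three_one
    have e : 3 * q + 3 = 3 * (q + 1) := by ring
    rw [e] at h
    exact h

/-- **`Delayed N ⌈N/3⌉`** for every `N` (`⌈N/3⌉ = (N + 2) / 3`): pad the residue `N mod 3` with the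
rungs `Delayed 1 1`, `Delayed 2 1`. [cite: CoppersmithWinograd1990, §7] -/
theorem delayed_third (N : ℕ) : Delayed N ((N + 2) / 3) := by
  obtain ⟨q, r, hr, rfl⟩ : ∃ q r : ℕ, r < 3 ∧ N = 3 * q + r :=
    ⟨N / 3, N % 3, Nat.mod_lt _ (by norm_num), (Nat.div_add_mod N 3).symm⟩
  interval_cases r
  · have e : (3 * q + 0 + 2) / 3 = q := by omega
    rw [e, Nat.add_zero]
    exact delayed_three_mul q
  · have e : (3 * q + 1 + 2) / 3 = q + 1 := by omega
    rw [e]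
    exact delayed_add (delayed_three_mul q) delayed_one_one
  · have e : (3 * q + 2 + 2) / 3 = q + 1 := by omega
    rw [e]
    exact delayed_add (delayed_three_mul q) delayed_two_one

/-- **`d(N) ≤ ⌈N/3⌉`** — the delay ladder has slope at most `1/3` (was `1/2`,
`delayNumber_le_half`). [cite: CoppersmithWinograd1990, §7] -/
theorem delayNumber_le_third (N : ℕ) : delayNumber N ≤ (N + 2) / 3 :=
  delayNumber_le (delayed_third N)

/-- `d(3q) ≤ q`. [cite: CoppersmithWinograd1990, §7] -/
theorem delayNumber_three_mul_le (q : ℕ) : delayNumber (3 * q) ≤ q :=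
  delayNumber_le (delayed_three_mul q)

/-- **The next undecided delay rungs**: `d(4), d(5) ∈ {1, 2}` and `d(6) ∈ {1, 2}` — the first
open delay question is now `Delayed 4 1 : C₁^{⊠5} ⊵ ⟨2,2,2⟩^{⊠4}`. [cite: CoppersmithWinograd1990, §7] -/
theorem delayNumber_four_five_six :
    (delayNumber 4 = 1 ∨ delayNumber 4 = 2) ∧ (delayNumber 5 = 1 ∨ delayNumber 5 = 2) ∧
      (delayNumber 6 = 1 ∨ delayNumber 6 = 2) := by
  have h4 : 1 ≤ delayNumber 4 := one_le_delayNumber (by norm_num)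
  have h4' : delayNumber 4 ≤ 2 := delayNumber_le_third 4
  have h5 : 1 ≤ delayNumber 5 := one_le_delayNumber (by norm_num)
  have h5' : delayNumber 5 ≤ 2 := delayNumber_le_third 5
  have h6 : 1 ≤ delayNumber 6 := one_le_delayNumber (by norm_num)
  have h6' : delayNumber 6 ≤ 2 := delayNumber_le_third 6
  omega

/-- `d(4) = 1 ⟺ Delayed 4 1` (the next rung, typed). [cite: CoppersmithWinograd1990, §7] -/
theorem delayNumber_four_eq_one_iff : delayNumber 4 = 1 ↔ Delayed 4 1 := by
  rw [delayed_iff_delayNumber_le]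
  have h1 : 1 ≤ delayNumber 4 := one_le_delayNumber (by norm_num)
  omega

end Complex

end Summit.MatrixMultiplication.MatrixMultiplication.Theorems.OutsiderSandwichDelayThree
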